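import Summits.QuantumFields.BalabanUV.T4Continuum.Spine.BackgroundResolventTower

/-!
# `BalabanUV.Beta.GAN24.InsertionChainLaw` — binder row G-an2-4 ∕ (CONV-C), routes R6 «VALUES, NOT DERIVATIVES» × R7 «TWO CURRENCIES» in
# NE2's operator currency, PART 115: THE u-DERIVATIVE INSERTION CHAINS OBEY THE ONE-STEP LAW — ALGEBRAICALLY.  For free propagators `G, G′` at two
# adjacent spacings, an injection `J`, a normalised averaging `Ã` (`ÃJ = 1 + F`) and a perturbation pair `P, P′` (the background's insertion
# operator at the two spacings), the `n`-th order INSERTION CHAIN `T_n = (GP)^n G = G(PG)^n` (`= (−1)^n ×` the `n`-th Taylor coefficient of the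
# perturbed resolvent `t ↦ (D + tP)⁻¹`, `G = D⁻¹`; `n = 1`: `GPG` = the first background insertion `G·𝒱·G`, `n = 2`: `GPGPG`) satisfies the
# INJECTED law `‖T′_nJ − JT_n‖ ≤ (n+1)κ^n e₁ + nκ^{n−1}e₂` and the SANDWICHED law `‖ÃT′_nÃᴴ − T_n‖ ≤ (n+1)κ^n e₁ + nκ^{n−1}e₂ + κ^n(e₀ + 2f)` from
# the five letters of NE2's resolvent route ((H-bd) `κ`, (H-cons) `e₂`, injected `e₁`, complement `e₀`, pairing `f`) by an EXACT Leibniz recursion —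
# no analyticity, no Cauchy estimate, no Landau–Kolmogorov interpolation, NO LOSS IN THE EXPONENT; along a tower with `FreeTowerLaws` +
# `PerturbationLaws`: `OneStepAveragedLaw` ∕ `TowerLimitRate` for every insertion order (unit b2b-balaban-gan24-p3, gen 51; v1)

NOT IN PRINT; OUR PROOF ([folklore] finite-dimensional algebra in the `ℓ²`-operator norm over the t4-ne2-p1 lineage's
`Spine/BackgroundResolventLaw` ∕ `Spine/BackgroundResolventTower` (generation 9 of NE2's road P1: `FreeTowerLaws`, `PerturbationLaws`,
`oneStepAveragedLaw_perturbed`) and `Spine/CovariantAveragingTower` (`OneStepAveragedLaw`, `TowerLimitRate`) BY NAME; [King1986] Lemma 4.5 (4.32) ∕ p. 665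
«replace one by one every factor … the error is the same graph with a difference of propagators on one line» is the printed pattern of the Leibniz step,
method reference only — nothing of it is a hypothesis).
HONEST FRAMING (cell contract, verbatim): «discharging `BetaPertH` makes Bałaban's UV stability UNCONDITIONAL — a real constructive-QFT result; it is NOT the
continuum limit and NOT the Clay problem.»  HONEST DEPENDENCY (verbatim): «continuum YM on T⁴ ⇐ BetaPertH ∧ nine spine estimates (0/9 proved); BetaPertH ⇐
(D1) ∧ (D4) ∧ CAP+tail; G-an2-4 gates asym, D1 and NE2/3/4.»

WHY THIS FILE.  (CONV-C)'s OPEN sector at `U = 1` is the u-DERIVATIVE sector (ROUTES-GAN24 (0.2) v4 note: «the OPEN constituents of (CONV-C) at U = 1 are exactly the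
u-derivative insertions (T1–T8)»): the constituents `K_u, K_{uu′}, …` of (MF′) are DERIVATIVES at `t = 0` of background-dependent propagators `G_k(U_t)` — chains
`G·𝒱·G`, `G·𝒱·G·𝒱·G` with local vertices `𝒱`.  Route R6 («VALUES, NOT DERIVATIVES», this lineage's PARTs 1–6, `GAN24/DerivativeRateTransfer*`) transfers VALUE rates along a
background family to DERIVATIVE rates by real-variable Landau–Kolmogorov interpolation — at the price `θ ↦ θ^{1∕2}` (`transfer₁`) ∕ `θ^{1∕3}` (`transfer₂`) and of value
rates WITH background; route R7 («TWO CURRENCIES») asks for the rate half in OPERATOR currency by a Leibniz sum.  Meanwhile NE2's road P1 (generations 8–10 and its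
swarm) TYPED the with-background one-step law in operator currency as `PerturbationLaws` ((H-bd) relative bound `κ`, (H-cons) two-spacing consistency `e₂`) over the
`U = 1` `FreeTowerLaws`, proved `oneStepAveragedLaw_perturbed` for the VALUES `(D_k + tP_k)⁻¹` (all `‖t‖κ < 1`), and DISCHARGED `PerturbationLaws` for the first-order
minimal-coupling model (`Support/FirstOrderBackgroundModel.perturbationLaws_firstOrder`), the Gram ∕ gauge-term shapes and — conditionally on node NE3's binder —
Bałaban's shaped operator (`Spine/NE2BalabanFinalRate`).  THIS FILE closes the triangle: the SAME five letters give the one-step law of EVERY TAYLOR COEFFICIENT of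
the perturbed resolvent — i.e. of every u-derivative insertion chain — by pure algebra, with constants `(n+1)κ^n e₁ + nκ^{n−1}e₂ + κ^n(e₀ + 2f)` LINEAR in the
letters and NO loss in the rate: R6's transfer made lossless in R7's currency, on NE2's typed interface.  Every discharge of `PerturbationLaws` in the tree (today:
the first-order model, unconditionally; Bałaban's shape, conditionally) is thereby AT ONCE a rate theorem for the derivative sector of that model (instance file:
PART 116 `GAN24/InsertionChainLawKing`).

WHAT THIS FILE PROVES (0 sorry, 0 `def`, nothing cited; complex matrices, `ℓ²`-operator norm; `G, P : n × n`, `G′, P′ : m × m`, `J : m × n`, `Ã : n × m`, `F : n × n`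
ANY matrices — no invertibility is used in §1–§3):
* §1 `pow_mul_shift` (`(GP)^nG = G(PG)^n`), `opNorm_pow_le` (`‖X^n‖ ≤ κ^n` from `‖X‖ ≤ κ`), `natCast_mul_mul_pow_pred` (the index arithmetic `k·(κ·κ^{k−1}) = k·κ^k`).
* §2 THE LEIBNIZ RECURSION **`insertion_succ_sub_eq`** (EXACT): `T′_{k+1}J − JT_{k+1} = G′P′·(T′_kJ − JT_k) + (G′(P′J − JP) + (G′J − JG)P)·T_k`, the source identity
  **`insertion_source_eq`** (`(G′(P′J − JP) + (G′J − JG)P)·T_k = E₂·(PG)^k + E₁·(PG)^{k+1}`, `E₁ = G′J − JG`, `E₂ = G′(P′J − JP)G`), and **`opNorm_insertion_injected_le`**: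
  `‖PG‖, ‖G′P′‖ ≤ κ`, `‖E₁‖ ≤ e₁`, `‖E₂‖ ≤ e₂` ⟹ `‖T′_kJ − JT_k‖ ≤ (k+1)κ^k e₁ + kκ^{k−1}e₂` (all `k`; `k = 1`: `2κe₁ + e₂`, `k = 2`: `3κ²e₁ + 2κe₂` —
  `opNorm_insertion_injected_le_one ∕ _two`).
* §3 **`opNorm_insertion_sandwich_le`**: with `‖GP‖ ≤ κ`, `‖Ã‖, ‖J‖ ≤ 1`, `ÃJ = 1 + F`, `‖FG‖, ‖GFᴴ‖ ≤ f`, `‖G′(1 − JJᴴ)‖ ≤ e₀` in addition: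
  `‖ÃT′_kÃᴴ − T_k‖ ≤ (k+1)κ^k e₁ + kκ^{k−1}e₂ + κ^k(e₀ + 2f)` — from `ÃT′Ãᴴ − T = Ã((T′J − JT)Jᴴ + T′(1 − JJᴴ))Ãᴴ + (FG)(PG)^k(ÃJ)ᴴ + (GP)^k(GFᴴ)`.
* §4 ALONG A TOWER (`FreeTowerLaws D A J F r e₀ e₁ f`, `PerturbationLaws D P J κ e₂`, `G_k = D_k⁻¹`): **`oneStepAveragedLaw_insertion`**
  (`OneStepAveragedLaw A r (k ↦ (D_k⁻¹P_k)^nD_k⁻¹) (k ↦ (n+1)κ^n e₁ k + nκ^{n−1}e₂ k + κ^n(e₀ k + 2f k))`, every `n`) and **`towerLimitRate_insertion`** (geometric letters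
  `≤ C·ρ^k`, `ρ < 1` ⟹ `TowerLimitRate A r (k ↦ (D_k⁻¹P_k)^nD_k⁻¹) ((n+1)κ^nC₁ + nκ^{n−1}C₂ + κ^n(C₀ + 2C_f)) ρ`): the unit-lattice images of the `n`-th insertion chain
  CONVERGE with rate `ρ^k`, at the VALUES' rate `ρ`, for every order `n`.
* §5 WHY `T_n` IS THE `n`-TH DERIVATIVE: **`inv_add_smul_eq_sum_add_remainder`** — for invertible `D`, `‖PD⁻¹‖ ≤ κ`, `‖t‖κ < 1` and every `n`:
  `(D + tP)⁻¹ = Σ_{j<n} (−t)^j·(D⁻¹P)^jD⁻¹ + (−t)^n·(D + tP)⁻¹(PD⁻¹)^n` (EXACT finite Neumann ∕ Taylor expansion; remainder `≤ (‖t‖κ)^n‖D⁻¹‖(1 − ‖t‖κ)⁻¹`,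
  `opNorm_inv_add_smul_sub_sum_le`) — so `(−1)^nT_n` is the `n`-th Taylor coefficient of the perturbed resolvent at `t = 0`, the object R6 differentiates.
WHAT IT DOES NOT DO: discharge `PerturbationLaws` for Bałaban's `Δ_a(U) − Δ_a(1)` (NE2's END of record does, conditionally on node NE3's binder; the first-order model is
unconditional — PART 116 instantiates both shapes BY NAME); touch the DECAY half of (CONV-C) ((H2); the join is road P1's `decayCauchy_of_uniformDecays_supRate`);
identify Bałaban's Table-T vertices `𝒱` (S1 of R7, typing).  SUPPLIER work (junction R6 × R7 × NE2 resolvent route); no consumer of record; NEVER «G-an2-4 closed»; NOT (CONV-C),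
NOT D1, NOT `BetaPertH`, NOT continuum, NOT Clay.  Records: `HOME/b2b-balaban-gan24-p3/gen51/README.md`.
-/

noncomputable section

open scoped BigOperators ComplexConjugate Matrix Matrix.Norms.L2Operator
open Filter Topology

namespace Summit.QuantumFields.BalabanUV.Beta.GAN24.InsertionChainLaw

open Summit.QuantumFields.BalabanUV.T4Continuum
open Summit.QuantumFields.BalabanUV.T4Continuum.BackgroundResolventLaw (l2_opNorm_one_le inv_add_smul_sub_inv isUnit_det_add_smul_right
  opNorm_inv_add_smul_le)
open Summit.QuantumFields.BalabanUV.T4Continuum.CovariantAveragingTower (OneStepAveragedLaw TowerLimitRate towerLimitRate_of_oneStepAveragedLaw)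
open Summit.QuantumFields.BalabanUV.T4Continuum.BackgroundResolventTower (FreeTowerLaws PerturbationLaws opNorm_normalised_le)

/-! ## §1 Powers: the shift identity, the norm bound, one line of index arithmetic -/

section Powers

variable {m : Type*} [Fintype m] [DecidableEq m]

/-- **the shift identity** `(G·P)^n·G = G·(P·G)^n`. [folklore] -/
theorem pow_mul_shift (G P : Matrix m m ℂ) (n : ℕ) : (G * P) ^ n * G = G * (P * G) ^ n := by
  induction n with
  | zero => rw [pow_zero, pow_zero, Matrix.one_mul, Matrix.mul_one]
  | succ n ih =>
    rw [pow_succ, pow_succ, Matrix.mul_assoc ((G * P) ^ n) (G * P) G, Matrix.mul_assoc G P G,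
      ← Matrix.mul_assoc ((G * P) ^ n) G (P * G), ih, Matrix.mul_assoc]

/-- `‖X^n‖ ≤ κ^n` from `‖X‖ ≤ κ` (`ℓ²`-operator norm; `‖1‖ ≤ 1` also on an empty index type). [folklore] -/
theorem opNorm_pow_le {X : Matrix m m ℂ} {κ : ℝ} (hX : ‖X‖ ≤ κ) (n : ℕ) : ‖X ^ n‖ ≤ κ ^ n := by
  have hκ : 0 ≤ κ := (norm_nonneg _).trans hX
  induction n with
  | zero => rw [pow_zero, pow_zero]; exact l2_opNorm_one_le
  | succ n ih =>
    rw [pow_succ, pow_succ]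
    exact (Matrix.l2_opNorm_mul _ _).trans (mul_le_mul ih hX (norm_nonneg _) (pow_nonneg hκ n))

/-- the index arithmetic of the recursion: `k·(κ·κ^{k−1}) = k·κ^k` (both sides vanish at `k = 0`). [folklore] -/
theorem natCast_mul_mul_pow_pred (κ : ℝ) (k : ℕ) : (k : ℝ) * (κ * κ ^ (k - 1)) = k * κ ^ k := by
  cases k with
  | zero => simp
  | succ j => rw [Nat.add_sub_cancel, ← pow_succ']

end Powers

/-! ## §2 The injected law of the `k`-th insertion chain: the exact Leibniz recursion and the bound -/

section TwoLevel

variable {m n : Type*} [Fintype m] [DecidableEq m] [Fintype n] [DecidableEq n]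
variable {G P : Matrix n n ℂ} {G' P' : Matrix m m ℂ} {J : Matrix m n ℂ}

/-- **THE LEIBNIZ RECURSION** (EXACT, no hypothesis): with `T_k = (GP)^kG`, `T′_k = (G′P′)^kG′`,
`T′_{k+1}J − JT_{k+1} = G′P′·(T′_kJ − JT_k) + (G′(P′J − JP) + (G′J − JG)P)·T_k` — «replace the outermost factor, the error is the same chain with the
differenced factor» ([King1986] p. 665, pattern only). [our proof] -/
theorem insertion_succ_sub_eq (k : ℕ) :
    (G' * P') ^ (k + 1) * G' * J - J * ((G * P) ^ (k + 1) * G)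
      = G' * P' * ((G' * P') ^ k * G' * J - J * ((G * P) ^ k * G))
        + (G' * (P' * J - J * P) + (G' * J - J * G) * P) * ((G * P) ^ k * G) := by
  simp only [pow_succ', Matrix.mul_sub, Matrix.sub_mul, Matrix.add_mul, Matrix.mul_assoc]
  abel

omit [DecidableEq m] in
/-- **THE SOURCE TERM READ THROUGH THE TWO DEFECTS**: `(G′(P′J − JP) + (G′J − JG)P)·(GP)^kG = E₂·(PG)^k + E₁·(PG)^{k+1}`, `E₂ = G′(P′J − JP)G` (the (H-cons)
quantity), `E₁ = G′J − JG` (the free injected defect). [our proof] -/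
theorem insertion_source_eq (k : ℕ) :
    (G' * (P' * J - J * P) + (G' * J - J * G) * P) * ((G * P) ^ k * G)
      = G' * (P' * J - J * P) * G * (P * G) ^ k + (G' * J - J * G) * (P * G) ^ (k + 1) := by
  rw [Matrix.add_mul, pow_mul_shift, pow_succ' (P * G) k]
  simp only [Matrix.mul_assoc]

/-- **`opNorm_insertion_injected_le` — THE INJECTED ONE-STEP LAW OF THE `k`-TH INSERTION CHAIN** [our proof]: `‖PG‖ ≤ κ`, `‖G′P′‖ ≤ κ` ((H-bd) at the two
spacings), `‖G′J − JG‖ ≤ e₁` (free injected defect), `‖G′(P′J − JP)G‖ ≤ e₂` ((H-cons)) ⟹ for every `k`,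
`‖(G′P′)^kG′·J − J·(GP)^kG‖ ≤ (k+1)·κ^k·e₁ + k·κ^{k−1}·e₂` — by induction on the Leibniz recursion (`b_{k+1} ≤ κb_k + e₂κ^k + e₁κ^{k+1}`, `b₀ ≤ e₁`). -/
theorem opNorm_insertion_injected_le {κ e₁ e₂ : ℝ} (hPG : ‖P * G‖ ≤ κ) (hG'P' : ‖G' * P'‖ ≤ κ)
    (h₁ : ‖G' * J - J * G‖ ≤ e₁) (h₂ : ‖G' * (P' * J - J * P) * G‖ ≤ e₂) (k : ℕ) :
    ‖(G' * P') ^ k * G' * J - J * ((G * P) ^ k * G)‖ ≤ (k + 1) * κ ^ k * e₁ + k * κ ^ (k - 1) * e₂ := by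
  have hκ : 0 ≤ κ := (norm_nonneg _).trans hPG
  have he₁ : 0 ≤ e₁ := (norm_nonneg _).trans h₁
  have he₂ : 0 ≤ e₂ := (norm_nonneg _).trans h₂
  induction k with
  | zero =>
    simp only [pow_zero, Nat.cast_zero, zero_add, one_mul, zero_mul, add_zero]
    exact h₁
  | succ k ih =>
    rw [insertion_succ_sub_eq, insertion_source_eq]
    have t1 : ‖G' * P' * ((G' * P') ^ k * G' * J - J * ((G * P) ^ k * G))‖ ≤ κ * (((k : ℝ) + 1) * κ ^ k * e₁ + (k : ℝ) * κ ^ (k - 1) * e₂) :=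
      (Matrix.l2_opNorm_mul _ _).trans (mul_le_mul hG'P' ih (norm_nonneg _) hκ)
    have t2 : ‖G' * (P' * J - J * P) * G * (P * G) ^ k‖ ≤ e₂ * κ ^ k :=
      (Matrix.l2_opNorm_mul _ _).trans (mul_le_mul h₂ (opNorm_pow_le hPG k) (norm_nonneg _) he₂)
    have t3 : ‖(G' * J - J * G) * (P * G) ^ (k + 1)‖ ≤ e₁ * κ ^ (k + 1) :=
      (Matrix.l2_opNorm_mul _ _).trans (mul_le_mul h₁ (opNorm_pow_le hPG (k + 1)) (norm_nonneg _) he₁)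
    have hk := natCast_mul_mul_pow_pred κ k
    have harith : κ * (((k : ℝ) + 1) * κ ^ k * e₁ + (k : ℝ) * κ ^ (k - 1) * e₂) + (e₂ * κ ^ k + e₁ * κ ^ (k + 1))
        = (((k + 1 : ℕ) : ℝ) + 1) * κ ^ (k + 1) * e₁ + ((k + 1 : ℕ) : ℝ) * κ ^ (k + 1 - 1) * e₂ := by
      have hk' : κ * ((k : ℝ) * κ ^ (k - 1) * e₂) = (k : ℝ) * κ ^ k * e₂ := by
        calc κ * ((k : ℝ) * κ ^ (k - 1) * e₂) = ((k : ℝ) * (κ * κ ^ (k - 1))) * e₂ := by ring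
          _ = (k : ℝ) * κ ^ k * e₂ := by rw [hk]
      rw [Nat.add_sub_cancel]
      push_cast
      simp only [pow_succ]
      linear_combination hk'
    calc ‖G' * P' * ((G' * P') ^ k * G' * J - J * ((G * P) ^ k * G))
            + (G' * (P' * J - J * P) * G * (P * G) ^ k + (G' * J - J * G) * (P * G) ^ (k + 1))‖
        ≤ ‖G' * P' * ((G' * P') ^ k * G' * J - J * ((G * P) ^ k * G))‖
            + (‖G' * (P' * J - J * P) * G * (P * G) ^ k‖ + ‖(G' * J - J * G) * (P * G) ^ (k + 1)‖) :=
          (norm_add_le _ _).trans (add_le_add le_rfl (norm_add_le _ _))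
      _ ≤ κ * (((k : ℝ) + 1) * κ ^ k * e₁ + (k : ℝ) * κ ^ (k - 1) * e₂) + (e₂ * κ ^ k + e₁ * κ ^ (k + 1)) := add_le_add t1 (add_le_add t2 t3)
      _ = (((k + 1 : ℕ) : ℝ) + 1) * κ ^ (k + 1) * e₁ + ((k + 1 : ℕ) : ℝ) * κ ^ (k + 1 - 1) * e₂ := harith

/-- `k = 1`: **the FIRST-ORDER INSERTION `G𝒱G`** — `‖G′P′G′·J − J·GPG‖ ≤ 2κe₁ + e₂`. [our proof] -/
theorem opNorm_insertion_injected_le_one {κ e₁ e₂ : ℝ} (hPG : ‖P * G‖ ≤ κ) (hG'P' : ‖G' * P'‖ ≤ κ)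
    (h₁ : ‖G' * J - J * G‖ ≤ e₁) (h₂ : ‖G' * (P' * J - J * P) * G‖ ≤ e₂) :
    ‖G' * P' * G' * J - J * (G * P * G)‖ ≤ 2 * κ * e₁ + e₂ := by
  have h := opNorm_insertion_injected_le hPG hG'P' h₁ h₂ 1
  simp only [pow_one, Nat.cast_one, Nat.sub_self, pow_zero, mul_one, one_mul] at h
  calc ‖G' * P' * G' * J - J * (G * P * G)‖ ≤ (1 + 1) * κ * e₁ + e₂ := h
    _ = 2 * κ * e₁ + e₂ := by norm_num

/-- `k = 2`: **the SECOND-ORDER INSERTION `G𝒱G𝒱G`** — `‖(G′P′)²G′·J − J·(GP)²G‖ ≤ 3κ²e₁ + 2κe₂`. [our proof] -/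
theorem opNorm_insertion_injected_le_two {κ e₁ e₂ : ℝ} (hPG : ‖P * G‖ ≤ κ) (hG'P' : ‖G' * P'‖ ≤ κ)
    (h₁ : ‖G' * J - J * G‖ ≤ e₁) (h₂ : ‖G' * (P' * J - J * P) * G‖ ≤ e₂) :
    ‖(G' * P') ^ 2 * G' * J - J * ((G * P) ^ 2 * G)‖ ≤ 3 * κ ^ 2 * e₁ + 2 * κ * e₂ := by
  have h := opNorm_insertion_injected_le hPG hG'P' h₁ h₂ 2
  have e : (2 : ℕ) - 1 = 1 := rfl
  simp only [Nat.cast_ofNat, e, pow_one] at h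
  calc _ ≤ (2 + 1) * κ ^ 2 * e₁ + 2 * κ * e₂ := h
    _ = 3 * κ ^ 2 * e₁ + 2 * κ * e₂ := by norm_num

/-! ## §3 The sandwiched law of the `k`-th insertion chain -/

/-- **`opNorm_insertion_sandwich_le` — THE SANDWICHED ONE-STEP LAW OF THE `k`-TH INSERTION CHAIN** [our proof] (the currency of
`CovariantAveragingTower.OneStepAveragedLaw`): for a normalised averaging `Ã` (`‖Ã‖ ≤ 1`) with `ÃJ = 1 + F`, `‖J‖ ≤ 1`, pairing defects `‖FG‖, ‖GFᴴ‖ ≤ f`, complement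
defect `‖G′(1 − JJᴴ)‖ ≤ e₀`, and the letters of §2 plus `‖GP‖ ≤ κ`:
`‖Ã·(G′P′)^kG′·Ãᴴ − (GP)^kG‖ ≤ (k+1)κ^k e₁ + kκ^{k−1}e₂ + κ^k·(e₀ + 2f)` — from the exact split
`ÃT′Ãᴴ − T = Ã((T′J − JT)Jᴴ + T′(1 − JJᴴ))Ãᴴ + (FG)(PG)^k(ÃJ)ᴴ + (GP)^k(GFᴴ)`. -/
theorem opNorm_insertion_sandwich_le {κ e₀ e₁ e₂ f : ℝ} (hPG : ‖P * G‖ ≤ κ) (hGP : ‖G * P‖ ≤ κ) (hG'P' : ‖G' * P'‖ ≤ κ)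
    {At : Matrix n m ℂ} (hAt : ‖At‖ ≤ 1) (hJ : ‖J‖ ≤ 1) {F : Matrix n n ℂ} (hAJ : At * J = 1 + F)
    (hF : ‖F * G‖ ≤ f) (hF' : ‖G * Fᴴ‖ ≤ f) (h₀ : ‖G' * (1 - J * Jᴴ)‖ ≤ e₀) (h₁ : ‖G' * J - J * G‖ ≤ e₁)
    (h₂ : ‖G' * (P' * J - J * P) * G‖ ≤ e₂) (k : ℕ) :
    ‖At * ((G' * P') ^ k * G') * Atᴴ - (G * P) ^ k * G‖
      ≤ ((k + 1) * κ ^ k * e₁ + k * κ ^ (k - 1) * e₂) + κ ^ k * (e₀ + 2 * f) := by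
  set T : Matrix n n ℂ := (G * P) ^ k * G with hTdef
  set T' : Matrix m m ℂ := (G' * P') ^ k * G' with hT'def
  have hκ : 0 ≤ κ := (norm_nonneg _).trans hPG
  have hf : 0 ≤ f := (norm_nonneg _).trans hF
  have he₀ : 0 ≤ e₀ := (norm_nonneg _).trans h₀
  -- the algebra
  have e2 : At * (J * T * Jᴴ) * Atᴴ = (At * J) * T * (At * J)ᴴ := by
    rw [Matrix.conjTranspose_mul]; simp only [Matrix.mul_assoc]
  have e : At * T' * Atᴴ - T = At * (T' - J * T * Jᴴ) * Atᴴ + F * T * (At * J)ᴴ + T * Fᴴ := by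
    rw [Matrix.mul_sub, Matrix.sub_mul, e2, hAJ, Matrix.conjTranspose_add, Matrix.conjTranspose_one]
    simp only [Matrix.add_mul, Matrix.mul_add, Matrix.one_mul, Matrix.mul_one]
    abel
  have e3 : T' - J * T * Jᴴ = (T' * J - J * T) * Jᴴ + T' * (1 - J * Jᴴ) := by
    rw [Matrix.sub_mul, Matrix.mul_sub, Matrix.mul_one, Matrix.mul_assoc T' J Jᴴ]
    abel
  have eT : F * T = F * G * (P * G) ^ k := by rw [hTdef, pow_mul_shift, Matrix.mul_assoc]
  have eT' : T' * (1 - J * Jᴴ) = (G' * P') ^ k * (G' * (1 - J * Jᴴ)) := by rw [hT'def, Matrix.mul_assoc]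
  have eTF : T * Fᴴ = (G * P) ^ k * (G * Fᴴ) := by rw [hTdef, Matrix.mul_assoc]
  rw [e, e3]
  -- the norms
  have hAt' : ‖Atᴴ‖ ≤ 1 := by rw [Matrix.l2_opNorm_conjTranspose]; exact hAt
  have hJ' : ‖Jᴴ‖ ≤ 1 := by rw [Matrix.l2_opNorm_conjTranspose]; exact hJ
  have hAJn : ‖(At * J)ᴴ‖ ≤ 1 := by
    rw [Matrix.l2_opNorm_conjTranspose]
    calc ‖At * J‖ ≤ ‖At‖ * ‖J‖ := Matrix.l2_opNorm_mul _ _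
      _ ≤ 1 * 1 := mul_le_mul hAt hJ (norm_nonneg _) zero_le_one
      _ = 1 := one_mul 1
  have hinj := opNorm_insertion_injected_le hPG hG'P' h₁ h₂ k
  have hinj0 : 0 ≤ ((k : ℝ) + 1) * κ ^ k * e₁ + (k : ℝ) * κ ^ (k - 1) * e₂ := (norm_nonneg _).trans hinj
  have hPGk := opNorm_pow_le hPG k
  have hGPk := opNorm_pow_le hGP k
  have hG'P'k := opNorm_pow_le hG'P' k
  have hκk : 0 ≤ κ ^ k := pow_nonneg hκ k
  have t1 : ‖(T' * J - J * T) * Jᴴ + T' * (1 - J * Jᴴ)‖ ≤ (((k : ℝ) + 1) * κ ^ k * e₁ + (k : ℝ) * κ ^ (k - 1) * e₂) + κ ^ k * e₀ := by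
    refine (norm_add_le _ _).trans (add_le_add ?_ ?_)
    · calc ‖(T' * J - J * T) * Jᴴ‖ ≤ ‖T' * J - J * T‖ * ‖Jᴴ‖ := Matrix.l2_opNorm_mul _ _
        _ ≤ (((k : ℝ) + 1) * κ ^ k * e₁ + (k : ℝ) * κ ^ (k - 1) * e₂) * 1 := mul_le_mul hinj hJ' (norm_nonneg _) hinj0
        _ = _ := mul_one _
    · rw [eT']
      exact (Matrix.l2_opNorm_mul _ _).trans (mul_le_mul hG'P'k h₀ (norm_nonneg _) hκk)
  have t1' : ‖At * ((T' * J - J * T) * Jᴴ + T' * (1 - J * Jᴴ)) * Atᴴ‖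
      ≤ (((k : ℝ) + 1) * κ ^ k * e₁ + (k : ℝ) * κ ^ (k - 1) * e₂) + κ ^ k * e₀ := by
    have h0 : 0 ≤ (((k : ℝ) + 1) * κ ^ k * e₁ + (k : ℝ) * κ ^ (k - 1) * e₂) + κ ^ k * e₀ := by positivity
    calc _ ≤ ‖At * ((T' * J - J * T) * Jᴴ + T' * (1 - J * Jᴴ))‖ * ‖Atᴴ‖ := Matrix.l2_opNorm_mul _ _
      _ ≤ ‖At‖ * ‖(T' * J - J * T) * Jᴴ + T' * (1 - J * Jᴴ)‖ * ‖Atᴴ‖ :=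
          mul_le_mul_of_nonneg_right (Matrix.l2_opNorm_mul _ _) (norm_nonneg _)
      _ ≤ 1 * ((((k : ℝ) + 1) * κ ^ k * e₁ + (k : ℝ) * κ ^ (k - 1) * e₂) + κ ^ k * e₀) * 1 :=
          mul_le_mul (mul_le_mul hAt t1 (norm_nonneg _) zero_le_one) hAt' (norm_nonneg _) (by positivity)
      _ = _ := by ring
  have t2 : ‖F * T * (At * J)ᴴ‖ ≤ f * κ ^ k := by
    rw [eT]
    calc _ ≤ ‖F * G * (P * G) ^ k‖ * ‖(At * J)ᴴ‖ := Matrix.l2_opNorm_mul _ _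
      _ ≤ ‖F * G‖ * ‖(P * G) ^ k‖ * ‖(At * J)ᴴ‖ := mul_le_mul_of_nonneg_right (Matrix.l2_opNorm_mul _ _) (norm_nonneg _)
      _ ≤ f * κ ^ k * 1 := mul_le_mul (mul_le_mul hF hPGk (norm_nonneg _) hf) hAJn (norm_nonneg _) (mul_nonneg hf hκk)
      _ = _ := mul_one _
  have t3 : ‖T * Fᴴ‖ ≤ κ ^ k * f := by
    rw [eTF]
    exact (Matrix.l2_opNorm_mul _ _).trans (mul_le_mul hGPk hF' (norm_nonneg _) hκk)
  calc _ ≤ ‖At * ((T' * J - J * T) * Jᴴ + T' * (1 - J * Jᴴ)) * Atᴴ + F * T * (At * J)ᴴ‖ + ‖T * Fᴴ‖ := norm_add_le _ _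
    _ ≤ (‖At * ((T' * J - J * T) * Jᴴ + T' * (1 - J * Jᴴ)) * Atᴴ‖ + ‖F * T * (At * J)ᴴ‖) + ‖T * Fᴴ‖ :=
        add_le_add (norm_add_le _ _) le_rfl
    _ ≤ (((((k : ℝ) + 1) * κ ^ k * e₁ + (k : ℝ) * κ ^ (k - 1) * e₂) + κ ^ k * e₀) + f * κ ^ k) + κ ^ k * f :=
        add_le_add (add_le_add t1' t2) t3
    _ = (((k : ℝ) + 1) * κ ^ k * e₁ + (k : ℝ) * κ ^ (k - 1) * e₂) + κ ^ k * (e₀ + 2 * f) := by ring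

end TwoLevel

/-! ## §4 Along a tower: the one-step averaged law and the tower limit with rate, for every insertion order -/

section Tower

variable {ι : ℕ → Type*} [∀ k, Fintype (ι k)] [∀ k, DecidableEq (ι k)]
variable {D P : (k : ℕ) → Matrix (ι k) (ι k) ℂ} {A : (k : ℕ) → Matrix (ι k) (ι (k + 1)) ℂ}
  {J : (k : ℕ) → Matrix (ι (k + 1)) (ι k) ℂ} {F : (k : ℕ) → Matrix (ι k) (ι k) ℂ} {r κ : ℝ} {e₀ e₁ e₂ f : ℕ → ℝ}

/-- **`oneStepAveragedLaw_insertion` — THE ONE-STEP AVERAGED LAW OF THE `n`-TH INSERTION CHAIN ALONG A TOWER** [our proof]: under NE2's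
`FreeTowerLaws D A J F r e₀ e₁ f` (the `U = 1` inputs) and `PerturbationLaws D P J κ e₂` (the two typed with-background inequalities), for EVERY order `n`,
`OneStepAveragedLaw A r (k ↦ (D_k⁻¹P_k)^nD_k⁻¹) (k ↦ (n+1)κ^n e₁ k + nκ^{n−1}e₂ k + κ^n(e₀ k + 2f k))` — the VALUES' law (`oneStepAveragedLaw_perturbed`) is the
resummation of these; no coupling, no Neumann disc, no analyticity. -/
theorem oneStepAveragedLaw_insertion (hr : 0 < r) (hfree : FreeTowerLaws D A J F r e₀ e₁ f) (hpert : PerturbationLaws D P J κ e₂) (n : ℕ) :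
    OneStepAveragedLaw A r (fun k => ((D k)⁻¹ * P k) ^ n * (D k)⁻¹)
      (fun k => ((n + 1) * κ ^ n * e₁ k + n * κ ^ (n - 1) * e₂ k) + κ ^ n * (e₀ k + 2 * f k)) := by
  intro k
  have hs0 : 0 < Real.sqrt r := Real.sqrt_pos.mpr hr
  set At : Matrix (ι k) (ι (k + 1)) ℂ := (((Real.sqrt r : ℝ) : ℂ)) • A k with hAt_def
  have hAt : ‖At‖ ≤ 1 := opNorm_normalised_le hr (hfree.opNorm_A_sq_le k)
  have hAJ : At * J k = 1 + F k := by rw [hAt_def, Matrix.smul_mul]; exact hfree.A_mul_J k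
  have key := opNorm_insertion_sandwich_le (G := (D k)⁻¹) (G' := (D (k + 1))⁻¹) (P := P k) (P' := P (k + 1)) (J := J k)
    (hpert.opNorm_P_mul_inv_le k) (hpert.opNorm_inv_mul_P_le k) (hpert.opNorm_inv_mul_P_le (k + 1)) hAt (hfree.opNorm_J_le k) hAJ
    (hfree.opNorm_F_mul_inv_le k) (hfree.opNorm_inv_mul_F_le k) (hfree.complement_le k) (hfree.injected_le k) (hpert.consistent_le k) n
  -- `A X′ Aᴴ − r⁻¹X = r⁻¹·(Ã X′ Ãᴴ − X)`
  have hss : star ((((Real.sqrt r : ℝ) : ℂ))) = (((Real.sqrt r : ℝ) : ℂ)) := Complex.conj_ofReal _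
  have hsq : ((((Real.sqrt r : ℝ) : ℂ))) * (((Real.sqrt r : ℝ) : ℂ)) = (r : ℂ) := by
    rw [← Complex.ofReal_mul, Real.mul_self_sqrt hr.le]
  have hrC : (r : ℂ) ≠ 0 := by exact_mod_cast hr.ne'
  have e : A k * (((D (k + 1))⁻¹ * P (k + 1)) ^ n * (D (k + 1))⁻¹) * (A k)ᴴ - ((r : ℂ))⁻¹ • (((D k)⁻¹ * P k) ^ n * (D k)⁻¹)
      = ((r : ℂ))⁻¹ • (At * (((D (k + 1))⁻¹ * P (k + 1)) ^ n * (D (k + 1))⁻¹) * Atᴴ - ((D k)⁻¹ * P k) ^ n * (D k)⁻¹) := by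
    rw [hAt_def, Matrix.conjTranspose_smul, hss, Matrix.smul_mul, Matrix.smul_mul, Matrix.mul_smul, smul_smul, hsq,
      smul_sub, smul_smul, inv_mul_cancel₀ hrC, one_smul]
  rw [e, norm_smul, norm_inv, Complex.norm_real, Real.norm_of_nonneg hr.le]
  exact mul_le_mul_of_nonneg_left key (inv_nonneg.mpr hr.le)

/-- **`towerLimitRate_insertion` — THE TOWER LIMIT WITH RATE OF THE `n`-TH INSERTION CHAIN** [our proof]: geometric letters `e₀ k ≤ C₀ρ^k`, `e₁ k ≤ C₁ρ^k`,
`e₂ k ≤ C₂ρ^k`, `f k ≤ C_fρ^k`, `ρ < 1`, `r > 0` ⟹ `TowerLimitRate A r (k ↦ (D_k⁻¹P_k)^nD_k⁻¹) ((n+1)κ^nC₁ + nκ^{n−1}C₂ + κ^n(C₀ + 2C_f)) ρ`: the unit-lattice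
images `r^k·A^{(k)}·(D_k⁻¹P_k)^nD_k⁻¹·A^{(k)ᴴ}` of the `n`-th order u-derivative insertion CONVERGE, `‖c_k − c_∞‖ ≤ C_n·ρ^k/(1 − ρ)`, AT THE VALUES' RATE `ρ`. -/
theorem towerLimitRate_insertion (hr : 0 < r) (hfree : FreeTowerLaws D A J F r e₀ e₁ f) (hpert : PerturbationLaws D P J κ e₂)
    {ρ C₀ C₁ C₂ Cf : ℝ} (hρ1 : ρ < 1) (h₀ : ∀ k, e₀ k ≤ C₀ * ρ ^ k) (h₁ : ∀ k, e₁ k ≤ C₁ * ρ ^ k) (h₂ : ∀ k, e₂ k ≤ C₂ * ρ ^ k)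
    (hf : ∀ k, f k ≤ Cf * ρ ^ k) (n : ℕ) :
    TowerLimitRate A r (fun k => ((D k)⁻¹ * P k) ^ n * (D k)⁻¹)
      (((n + 1) * κ ^ n * C₁ + n * κ ^ (n - 1) * C₂) + κ ^ n * (C₀ + 2 * Cf)) ρ := by
  have hκ : 0 ≤ κ := (norm_nonneg _).trans (hpert.opNorm_P_mul_inv_le 0)
  have hlaw : OneStepAveragedLaw A r (fun k => ((D k)⁻¹ * P k) ^ n * (D k)⁻¹)
      (fun k => (((n + 1) * κ ^ n * C₁ + n * κ ^ (n - 1) * C₂) + κ ^ n * (C₀ + 2 * Cf)) * ρ ^ k) := by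
    intro k
    refine (oneStepAveragedLaw_insertion hr hfree hpert n k).trans (mul_le_mul_of_nonneg_left ?_ (inv_nonneg.mpr hr.le))
    have hκn : 0 ≤ κ ^ n := pow_nonneg hκ n
    have hκn' : 0 ≤ κ ^ (n - 1) := pow_nonneg hκ (n - 1)
    have a1 : (n + 1) * κ ^ n * e₁ k ≤ (n + 1) * κ ^ n * (C₁ * ρ ^ k) := mul_le_mul_of_nonneg_left (h₁ k) (by positivity)
    have a2 : n * κ ^ (n - 1) * e₂ k ≤ n * κ ^ (n - 1) * (C₂ * ρ ^ k) := mul_le_mul_of_nonneg_left (h₂ k) (by positivity)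
    have a3 : κ ^ n * (e₀ k + 2 * f k) ≤ κ ^ n * ((C₀ + 2 * Cf) * ρ ^ k) := by
      refine mul_le_mul_of_nonneg_left ?_ hκn
      nlinarith [h₀ k, hf k]
    nlinarith [a1, a2, a3]
  exact towerLimitRate_of_oneStepAveragedLaw A hr hfree.opNorm_A_sq_le _ hρ1 hlaw

end Tower

/-! ## §5 Why `T_n` is the `n`-th derivative: the exact finite Taylor expansion of the perturbed resolvent -/

section Taylor

variable {m : Type*} [Fintype m] [DecidableEq m] {D P : Matrix m m ℂ}

/-- **`inv_add_smul_eq_sum_add_remainder` — THE FINITE NEUMANN ∕ TAYLOR EXPANSION** [our proof]: for invertible `D`, `‖PD⁻¹‖ ≤ κ`, `‖t‖κ < 1` and every `n`,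
`(D + tP)⁻¹ = Σ_{j<n} (−t)^j·((D⁻¹P)^jD⁻¹) + (−t)^n·(D + tP)⁻¹·(PD⁻¹)^n` — EXACT; the `j`-th Taylor coefficient of the perturbed resolvent at `t = 0` is `(−1)^j·T_j`,
`T_j = (D⁻¹P)^jD⁻¹` the `j`-th insertion chain (by induction on the resolvent identity `(D + tP)⁻¹ = D⁻¹ − t·(D + tP)⁻¹PD⁻¹`). -/
theorem inv_add_smul_eq_sum_add_remainder (hD : IsUnit D.det) {t : ℂ} {κ : ℝ} (hP : ‖P * D⁻¹‖ ≤ κ) (ht : ‖t‖ * κ < 1) (n : ℕ) :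
    (D + t • P)⁻¹ = (∑ j ∈ Finset.range n, (-t) ^ j • ((D⁻¹ * P) ^ j * D⁻¹)) + (-t) ^ n • ((D + t • P)⁻¹ * (P * D⁻¹) ^ n) := by
  have hbase : (D + t • P)⁻¹ = D⁻¹ - t • ((D + t • P)⁻¹ * (P * D⁻¹)) := by
    have h := inv_add_smul_sub_inv hD hP ht
    have h2 : t • ((D + t • P)⁻¹ * P * D⁻¹) = -((D + t • P)⁻¹ - D⁻¹) := by rw [h, neg_neg]
    rw [← Matrix.mul_assoc, h2]
    abel
  induction n with
  | zero => rw [Finset.sum_range_zero, pow_zero, pow_zero, one_smul, Matrix.mul_one, zero_add]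
  | succ n ih =>
    -- substitute the resolvent identity into the remainder of order `n`
    have step : (-t) ^ n • ((D + t • P)⁻¹ * (P * D⁻¹) ^ n)
        = (-t) ^ n • ((D⁻¹ * P) ^ n * D⁻¹) + (-t) ^ (n + 1) • ((D + t • P)⁻¹ * (P * D⁻¹) ^ (n + 1)) := by
      rw [pow_mul_shift D⁻¹ P n, pow_succ (-t) n, pow_succ' (P * D⁻¹) n]
      conv_lhs => rw [hbase]
      rw [Matrix.sub_mul, Matrix.smul_mul, Matrix.mul_assoc, smul_sub, smul_smul, mul_neg, neg_smul, sub_eq_add_neg]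
    rw [Finset.sum_range_succ]
    conv_lhs => rw [ih, step]
    rw [add_assoc]

/-- **THE TAYLOR REMAINDER BOUND**: `‖(D + tP)⁻¹ − Σ_{j<n} (−t)^j·T_j‖ ≤ (‖t‖κ)^n·‖D⁻¹‖·(1 − ‖t‖κ)⁻¹`. [our proof] -/
theorem opNorm_inv_add_smul_sub_sum_le (hD : IsUnit D.det) {t : ℂ} {κ : ℝ} (hP : ‖P * D⁻¹‖ ≤ κ) (ht : ‖t‖ * κ < 1) (n : ℕ) :
    ‖(D + t • P)⁻¹ - ∑ j ∈ Finset.range n, (-t) ^ j • ((D⁻¹ * P) ^ j * D⁻¹)‖ ≤ (‖t‖ * κ) ^ n * (‖D⁻¹‖ * (1 - ‖t‖ * κ)⁻¹) := by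
  have hκ : 0 ≤ κ := (norm_nonneg _).trans hP
  have e : (D + t • P)⁻¹ - ∑ j ∈ Finset.range n, (-t) ^ j • ((D⁻¹ * P) ^ j * D⁻¹) = (-t) ^ n • ((D + t • P)⁻¹ * (P * D⁻¹) ^ n) := by
    conv_lhs => rw [inv_add_smul_eq_sum_add_remainder hD hP ht n]
    rw [add_sub_cancel_left]
  rw [e, norm_smul, norm_pow, norm_neg, mul_pow]
  have h1 := opNorm_inv_add_smul_le hD hP ht
  have h2 := opNorm_pow_le hP n
  have hν : 0 ≤ ‖D⁻¹‖ * (1 - ‖t‖ * κ)⁻¹ := mul_nonneg (norm_nonneg _) (inv_nonneg.mpr (sub_nonneg.mpr ht.le))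
  calc ‖t‖ ^ n * ‖(D + t • P)⁻¹ * (P * D⁻¹) ^ n‖ ≤ ‖t‖ ^ n * (‖(D + t • P)⁻¹‖ * ‖(P * D⁻¹) ^ n‖) :=
        mul_le_mul_of_nonneg_left (Matrix.l2_opNorm_mul _ _) (pow_nonneg (norm_nonneg t) n)
    _ ≤ ‖t‖ ^ n * ((‖D⁻¹‖ * (1 - ‖t‖ * κ)⁻¹) * κ ^ n) :=
        mul_le_mul_of_nonneg_left (mul_le_mul h1 h2 (norm_nonneg _) hν) (pow_nonneg (norm_nonneg t) n)
    _ = ‖t‖ ^ n * κ ^ n * (‖D⁻¹‖ * (1 - ‖t‖ * κ)⁻¹) := by ring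

end Taylor

end Summit.QuantumFields.BalabanUV.Beta.GAN24.InsertionChainLaw

end
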